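import Literature.NumberTheory.Automorphic.U3PrincipalSeriesJacquetFiltration
import HarnessLib

/-!
# N1 ★ `U3PrincipalSeriesJacquetFiltration`, conjuncts 1–2 UNFOLDED as a theorem: `r_B i_G(χ)` is finite-dimensional of dimension `2`

Companion of ★ `U3PrincipalSeriesLettersUnfold` (same rationale, see that file's docstring: the `def`'s private `_proof_k` aux constants make
every meeting of N1 with another letter or with a theorem-world term cost millions of heartbeats at the ≈ 7·10⁷-node type of the Jacquet module
of `cmPrincipalSeries L 3 v χ`).  Here the two conjuncts of N1 [Casselman1995, L. 7.1.1 (a)] that the length-two (Cor. 7.1.2) and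
square-integrability (Prop. 7.1.3) bookkeeping consume — `FiniteDimensional` and `finrank = 2` of `r_B i_G(χ)` — are restated VERBATIM as a
THEOREM (`finiteDimensional_finrank_eq_two_of_U3PrincipalSeriesJacquetFiltration`, proof = the projections `.1`, `.2.1` under
`set_option maxHeartbeats 4000000`; measured wall ≈ 260 s, paid once).  The third conjunct (the `wχ`-stable line) is not restated here: the full
`Iff.rfl` unfolding of N1 does not elaborate within 8·10⁶ heartbeats ∕ 590 s (measured) and should be bridged conjunct-wise by its consumer.
Theorems only; no definition, no named fact, no instance.

## References
[Casselman1995] L. 7.1.1 (a) p. 67, Thm. 6.3.5 p. 59 · [BernsteinZelevinsky1977] §2.12 Geometrical Lemma, Cor. 2.13 (c) · [Rogawski1990] §12.2 p. 173.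
-/

set_option autoImplicit false

noncomputable section

open MeasureTheory NumberField IsDedekindDomain
open scoped MatrixGroups NNReal

namespace Literature.NumberTheory.Automorphic

namespace UnitaryGroup

variable (L : Type) [Field L] [NumberField L] [IsCMField L]

set_option maxHeartbeats 4000000 in
/-- **N1, first two conjuncts, unfolded**: `r_B i_G(χ)` is finite-dimensional of dimension `2` (the part of ★ `U3PrincipalSeriesJacquetFiltration`
consumed by the length-two and square-integrability bookkeeping; the stable line is not restated here). [cite: Casselman1995, Lemma 7.1.1 (a) p. 67]
[cite: BernsteinZelevinsky1977, §2.12, Cor. 2.13 (c)] -/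
theorem finiteDimensional_finrank_eq_two_of_U3PrincipalSeriesJacquetFiltration (h : U3PrincipalSeriesJacquetFiltration L)
    (v : HeightOneSpectrum (𝓞 ↥(maximalRealSubfield L)))
    (hns : ∀ w : PlacesOver L v, IsCMField.complexConj L • w.1 = w.1)
    (χ₁ : (LocalRing L v)ˣ →* ℂˣ) (χ₂ : ↥(normOneUnits (conjLocal L (IsCMField.complexConj L) v)) →* ℂˣ)
    (h1c : Continuous (fun x => ((χ₁ x : ℂˣ) : ℂ))) (h2c : Continuous (fun x => ((χ₂ x : ℂˣ) : ℂ))) :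
    FiniteDimensional ℂ ((cmBorelTriple L 3 v).restrict (cmPrincipalSeries L 3 v (cmTorusCharPair L v χ₁ χ₂))).Coinvariants ∧
    Module.finrank ℂ ((cmBorelTriple L 3 v).restrict (cmPrincipalSeries L 3 v (cmTorusCharPair L v χ₁ χ₂))).Coinvariants = 2 :=
  ⟨(h v hns χ₁ χ₂ h1c h2c).1, (h v hns χ₁ χ₂ h1c h2c).2.1⟩

end UnitaryGroup

end Literature.NumberTheory.Automorphic

end
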